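import Mathlib
import Summits.Ventures.PercRepro2.OneTypedEdge

/-!
# The second kill: `a₃` joined to the two roots by typed edges of types `(1, 2)` (blind cell
PercRepro2, mine-2 g45, 2026-08-29; `conjectures/MINE-2.md` M2-91)

`a₃` carries the typed root edges `e₁ = a₁–a₃` with `τ e₁ ≥ 1` and `e₂ = a₂–a₃` with `τ e₂ ≥ 2`.
In every typed triple either some copy carries both edges — then `a₂ ↔ a₁` through `a₃` there and
the kernel vanishes (`KB_eq_zero_of_q'`) — or every copy carries one of them, so `a₃` lies in a root
cluster in EVERY copy, `1_PD = 0` in every copy, and the kernel vanishes because each of its eight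
terms has a `1_PD` factor in some copy (`KB_eq_zero_of_pd_all`).  Hence
**`typedCount_eq_zero_of_a3_root_one_two`**: every typed count of `K₃` vanishes — for every graph,
every `z`, every `F ∋ e₁, e₂` and every type vector with `τ e₁ ≥ 1`, `τ e₂ ≥ 2` (and the mirror
`typedCount_eq_zero_of_a3_root_two_one`).  On the seven-vertex census (M2-89/M2-90) these are
all-terms-zero type-level cells (on the statement `11000/01100/1`: all 4,374 cells with the root
digits `(1, 2)` or `(2, 1)` at `a₃`).  The `(2, 2)` case at any vertex is mine-2 g44's
`typedCount_eq_zero_of_root_two_two` (TypedRootTwoTwo.lean); the `(1, 1)` case does not kill (the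
third copy may have `a₃` free).  Own code; standard axioms.
-/

namespace Summit.Ventures.PercRepro2

open UnionCluster

namespace CovForm

namespace TypedRed

open OneTyped

section KillA3

open Classical

variable {V : Type*} {E : Type*} [Fintype E] [DecidableEq E] {R : Type*} [Field R]

/-- If `1_PD` vanishes in all three states, every kernel value vanishes (each of the eight terms of
`KB` carries a `pdB` factor in some copy). -/
theorem KB_eq_zero_of_pd_all (x y z : St) (hx : pdB x = 0) (hy : pdB y = 0) (hz : pdB z = 0) :
    KB x y z = 0 := by
  simp [KB, hx, hy, hz]

/-- A state with `a₃ ∈ C(a₁)` or `a₃ ∈ C(a₂)` has `1_PD = 0`. -/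
theorem pdB_eq_zero_of_L3_or_H3 (s : St) (h : s.L3 = true ∨ s.H3 = true) : pdB s = 0 := by
  rcases h with h | h <;> simp [pdB, h]

omit [Fintype E] [DecidableEq E] in
/-- Pigeonhole over three copies: an edge open in at least one copy and an edge open in at least
two copies are either both open in some copy, or every copy carries one of them. -/
lemma both_open_or_each_one (x y w : Config E) (e₁ e₂ : E) (h1 : 1 ≤ openCount x y w e₁)
    (h2 : 2 ≤ openCount x y w e₂) :
    (x e₁ = true ∧ x e₂ = true) ∨ (y e₁ = true ∧ y e₂ = true) ∨ (w e₁ = true ∧ w e₂ = true) ∨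
      ((x e₁ = true ∨ x e₂ = true) ∧ (y e₁ = true ∨ y e₂ = true) ∧
        (w e₁ = true ∨ w e₂ = true)) := by
  unfold openCount at h1 h2
  cases hx1 : x e₁ <;> cases hy1 : y e₁ <;> cases hw1 : w e₁ <;> cases hx2 : x e₂ <;>
    cases hy2 : y e₂ <;> cases hw2 : w e₂ <;> simp_all

omit [Fintype E] [DecidableEq E] in
/-- A copy carrying `a₁–a₃` and `a₂–a₃` has `a₂ ↔ a₁`: its state fails `Q`. -/
lemma st_q'_of_both_a3_root_edges (ends : E → Sym2 V) (o a₁ a₂ a₃ b : V) {e₁ e₂ : E}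
    (h1 : ends e₁ = s(a₁, a₃)) (h2 : ends e₂ = s(a₂, a₃)) (x : Config E) (hx1 : x e₁ = true)
    (hx2 : x e₂ = true) : (st ends o a₁ a₂ a₃ b x).q' = true := by
  show decide (Conn ends x a₂ a₁) = true
  have h23 : Conn ends x a₂ a₃ := conn_of_openAdj ⟨e₂, hx2, h2⟩
  have h13 : Conn ends x a₁ a₃ := conn_of_openAdj ⟨e₁, hx1, h1⟩
  exact decide_eq_true (conn_trans h23 (conn_symm h13))

omit [Fintype E] [DecidableEq E] in
/-- A copy carrying `a₁–a₃` has `a₃ ∈ C(a₁)`. -/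
lemma st_L3_of_edge (ends : E → Sym2 V) (o a₁ a₂ a₃ b : V) {e₁ : E} (h1 : ends e₁ = s(a₁, a₃))
    (x : Config E) (hx1 : x e₁ = true) : (st ends o a₁ a₂ a₃ b x).L3 = true := by
  show decide (Conn ends x a₁ a₃) = true
  exact decide_eq_true (conn_of_openAdj ⟨e₁, hx1, h1⟩)

omit [Fintype E] [DecidableEq E] in
/-- A copy carrying `a₂–a₃` has `a₃ ∈ C(a₂)`. -/
lemma st_H3_of_edge (ends : E → Sym2 V) (o a₁ a₂ a₃ b : V) {e₂ : E} (h2 : ends e₂ = s(a₂, a₃))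
    (x : Config E) (hx2 : x e₂ = true) : (st ends o a₁ a₂ a₃ b x).H3 = true := by
  show decide (Conn ends x a₂ a₃) = true
  exact decide_eq_true (conn_of_openAdj ⟨e₂, hx2, h2⟩)

omit [Fintype E] [DecidableEq E] in
/-- A copy carrying one of the two root edges of `a₃` has `1_PD = 0`. -/
lemma pdB_st_eq_zero_of_edge (ends : E → Sym2 V) (o a₁ a₂ a₃ b : V) {e₁ e₂ : E}
    (h1 : ends e₁ = s(a₁, a₃)) (h2 : ends e₂ = s(a₂, a₃)) (x : Config E)
    (hx : x e₁ = true ∨ x e₂ = true) : pdB (st ends o a₁ a₂ a₃ b x) = 0 := by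
  refine pdB_eq_zero_of_L3_or_H3 _ ?_
  rcases hx with hx | hx
  · exact Or.inl (st_L3_of_edge ends o a₁ a₂ a₃ b h1 x hx)
  · exact Or.inr (st_H3_of_edge ends o a₁ a₂ a₃ b h2 x hx)

/-- **The second kill**: `a₃` joined to `a₁` by a typed edge of type `≥ 1` and to `a₂` by a typed
edge of type `≥ 2` makes every typed count of `K₃` vanish. -/
theorem typedCount_eq_zero_of_a3_root_one_two (ends : E → Sym2 V) (o a₁ a₂ a₃ b : V)
    {e₁ e₂ : E} (h1 : ends e₁ = s(a₁, a₃)) (h2 : ends e₂ = s(a₂, a₃)) (F : Finset E)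
    (h1F : e₁ ∈ F) (h2F : e₂ ∈ F) (z : Config E) (τ : E → ℕ) (hτ1 : 1 ≤ τ e₁)
    (hτ2 : 2 ≤ τ e₂) :
    typedCount F z τ (K3 ends o a₁ a₂ a₃ b : Config E → Config E → Config E → R) = 0 := by
  unfold typedCount
  refine Finset.sum_eq_zero fun x _ => Finset.sum_eq_zero fun y _ => Finset.sum_eq_zero fun w _ => ?_
  split_ifs with h
  · have hc1 := h.2 e₁ h1F
    have hc2 := h.2 e₂ h2F
    rcases both_open_or_each_one x y w e₁ e₂ (by omega) (by omega) with
      ⟨hx1, hx2⟩ | ⟨hy1, hy2⟩ | ⟨hw1, hw2⟩ | ⟨hx, hy, hw⟩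
    · rw [K3_eq_KB, KB_eq_zero_of_q' _ _ _
        (Or.inl (st_q'_of_both_a3_root_edges ends o a₁ a₂ a₃ b h1 h2 x hx1 hx2))]
      simp
    · rw [K3_eq_KB, KB_eq_zero_of_q' _ _ _
        (Or.inr (Or.inl (st_q'_of_both_a3_root_edges ends o a₁ a₂ a₃ b h1 h2 y hy1 hy2)))]
      simp
    · rw [K3_eq_KB, KB_eq_zero_of_q' _ _ _
        (Or.inr (Or.inr (st_q'_of_both_a3_root_edges ends o a₁ a₂ a₃ b h1 h2 w hw1 hw2)))]
      simp
    · rw [K3_eq_KB, KB_eq_zero_of_pd_all _ _ _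
        (pdB_st_eq_zero_of_edge ends o a₁ a₂ a₃ b h1 h2 x hx)
        (pdB_st_eq_zero_of_edge ends o a₁ a₂ a₃ b h1 h2 y hy)
        (pdB_st_eq_zero_of_edge ends o a₁ a₂ a₃ b h1 h2 w hw)]
      simp
  · rfl

/-- The mirror: `a₃` joined to `a₁` by a typed edge of type `≥ 2` and to `a₂` by one of type `≥ 1`
(the roles of the two roots exchanged by the same pigeonhole). -/
theorem typedCount_eq_zero_of_a3_root_two_one (ends : E → Sym2 V) (o a₁ a₂ a₃ b : V)
    {e₁ e₂ : E} (h1 : ends e₁ = s(a₁, a₃)) (h2 : ends e₂ = s(a₂, a₃)) (F : Finset E)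
    (h1F : e₁ ∈ F) (h2F : e₂ ∈ F) (z : Config E) (τ : E → ℕ) (hτ1 : 2 ≤ τ e₁)
    (hτ2 : 1 ≤ τ e₂) :
    typedCount F z τ (K3 ends o a₁ a₂ a₃ b : Config E → Config E → Config E → R) = 0 := by
  unfold typedCount
  refine Finset.sum_eq_zero fun x _ => Finset.sum_eq_zero fun y _ => Finset.sum_eq_zero fun w _ => ?_
  split_ifs with h
  · have hc1 := h.2 e₁ h1F
    have hc2 := h.2 e₂ h2F
    rcases both_open_or_each_one x y w e₂ e₁ (by omega) (by omega) with
      ⟨hx2, hx1⟩ | ⟨hy2, hy1⟩ | ⟨hw2, hw1⟩ | ⟨hx, hy, hw⟩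
    · rw [K3_eq_KB, KB_eq_zero_of_q' _ _ _
        (Or.inl (st_q'_of_both_a3_root_edges ends o a₁ a₂ a₃ b h1 h2 x hx1 hx2))]
      simp
    · rw [K3_eq_KB, KB_eq_zero_of_q' _ _ _
        (Or.inr (Or.inl (st_q'_of_both_a3_root_edges ends o a₁ a₂ a₃ b h1 h2 y hy1 hy2)))]
      simp
    · rw [K3_eq_KB, KB_eq_zero_of_q' _ _ _
        (Or.inr (Or.inr (st_q'_of_both_a3_root_edges ends o a₁ a₂ a₃ b h1 h2 w hw1 hw2)))]
      simp
    · rw [K3_eq_KB, KB_eq_zero_of_pd_all _ _ _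
        (pdB_st_eq_zero_of_edge ends o a₁ a₂ a₃ b h1 h2 x hx.symm)
        (pdB_st_eq_zero_of_edge ends o a₁ a₂ a₃ b h1 h2 y hy.symm)
        (pdB_st_eq_zero_of_edge ends o a₁ a₂ a₃ b h1 h2 w hw.symm)]
      simp
  · rfl

end KillA3

end TypedRed

end CovForm

end Summit.Ventures.PercRepro2
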